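import Mathlib.RingTheory.FiniteLength
import Mathlib.RingTheory.Artinian.Ring
import Mathlib.Order.Monotone.Basic
import Literature.NumberTheory.Automorphic.SmoothProjector
import HarnessLib

/-!
# Admissible representations with a uniform level have finite length

Generic representation theory (no `GL_n`): the criterion by which finite length is eventually
established in Bernstein–Zelevinsky's theory. Let `ρ` be an admissible representation of a
topological group `G` on a vector space `V` over a field of characteristic zero and `K ≤ G` a
compact open subgroup. If **every non-zero subquotient of `ρ` has a non-zero `K`-fixed vector** —
phrased without quotient types as: for all subrepresentations `B < A` there is `v ∈ A` whose
`K`-average `e_K v` (`SmoothProjector.avg`) does not lie in `B` — then `ρ` has finite length as a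
module over the group algebra, indeed every chain of subrepresentations has at most `dim V^K`
strict steps: the map `A ↦ A ∩ V^K` from subrepresentations to subspaces of the
finite-dimensional space `V^K` is strictly monotone (`Representation.levelSubmodule_strictMono`),
so the lattice of subrepresentations (order-isomorphic to the lattice of `k[G]`-submodules,
Mathlib `Subrepresentation.subrepresentationSubmoduleOrderIso`) is well-founded in both
directions (`Representation.isFiniteLength_of_forall_lt_exists_avg_not_mem`).

This is the standard argument "`V ↦ V^K` is exact and faithful on the relevant subquotients,
hence `ℓ(V) ≤ dim V^K`" (Bernstein–Zelevinsky 1976, §2.1–2.3 and the proof of Thm. 4.1;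
Casselman 1995, §2.1; Bernstein's 1992 Harvard notes, the "decomposition by level"). Theorems and
one auxiliary definition (`levelSubmodule`); no named facts.

## References

* I. N. Bernstein, A. V. Zelevinsky, *Representations of the group `GL(n, F)` where `F` is a
  non-archimedean local field*, Russian Math. Surveys 31:3 (1976), §2.1–2.3, §4.1.
* W. Casselman, *Introduction to the theory of admissible representations of `p`-adic reductive
  groups* (1995 notes), §2.1.
-/

noncomputable section

open scoped MonoidAlgebra

namespace Representation

open Literature.NumberTheory.Automorphic.SmoothProjector

section Level

variable {k G V : Type*} [Field k] [Group G] [AddCommGroup V] [Module k V]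
  {ρ : Representation k G V}

/-- The **level-`K` part** `A ∩ V^K` of a subrepresentation `A`, as a subspace of the space
`V^K` of `K`-fixed vectors. [folklore] -/
def levelSubmodule (K : Subgroup G) (A : Subrepresentation ρ) : Submodule k (ρ.fixedPoints K) :=
  A.toSubmodule.comap (ρ.fixedPoints K).subtype

/-- Membership in the level-`K` part: `v ∈ A ∩ V^K ↔ (v : V) ∈ A`. [folklore] -/
@[simp] theorem mem_levelSubmodule (K : Subgroup G) (A : Subrepresentation ρ)
    (v : ρ.fixedPoints K) : v ∈ levelSubmodule K A ↔ (v : V) ∈ A :=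
  Iff.rfl

/-- `A ↦ A ∩ V^K` is monotone. [folklore] -/
theorem levelSubmodule_mono (K : Subgroup G) : Monotone (levelSubmodule (ρ := ρ) K) :=
  fun _ _ hAB _ hv => hAB hv

variable [CharZero k] [TopologicalSpace G] [IsTopologicalGroup G]

/-- The `K`-average of a smooth vector of a subrepresentation `A` lies in `A` (it is a rational
convex combination of `K`-translates). [folklore] -/
theorem avg_mem_of_mem {H : Subgroup G} (hH : IsCompact (H : Set G)) (A : Subrepresentation ρ)
    {v : V} (hv : v ∈ A) (hvs : ρ.IsSmoothVector v) : avg ρ H v ∈ A := by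
  haveI := finiteIndex_stabIn hH hvs
  haveI : Fintype (H ⧸ stabIn ρ H v) := Fintype.ofFinite _
  rw [avg_eq_index_inv_smul_finsum (stabIn ρ H v) le_rfl, finsum_eq_sum_of_fintype]
  exact A.toSubmodule.smul_mem _
    (A.toSubmodule.sum_mem fun q _ => A.apply_mem_toSubmodule _ hv)

/-- **Strict monotonicity of the level map.** If `ρ` is smooth, `K` is compact, and for all
subrepresentations `B < A` some `v ∈ A` has `e_K v ∉ B`, then `A ↦ A ∩ V^K` is strictly monotone:
`e_K v ∈ (A ∩ V^K) ∖ (B ∩ V^K)`. (Bernstein–Zelevinsky 1976, §2.3; Casselman 1995, §2.1.) [folklore] -/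
theorem levelSubmodule_strictMono (hρ : ρ.IsSmooth) {K : Subgroup G} (hK : IsCompact (K : Set G))
    (h : ∀ A B : Subrepresentation ρ, B < A → ∃ v ∈ A, avg ρ K v ∉ B) :
    StrictMono (levelSubmodule (ρ := ρ) K) := by
  intro B A hBA
  refine lt_of_le_of_ne (levelSubmodule_mono K hBA.le) fun hEq => ?_
  obtain ⟨v, hvA, hvB⟩ := h A B hBA
  have hmem : (⟨avg ρ K v, avg_mem_fixedPoints hK (hρ v)⟩ : ρ.fixedPoints K) ∈ levelSubmodule K A :=
    avg_mem_of_mem hK A hvA (hρ v)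
  rw [← hEq] at hmem
  exact hvB hmem

/-- **An admissible representation with a uniform level has finite length.** Let `ρ` be
admissible and `K` a compact open subgroup such that for all subrepresentations `B < A` some
`v ∈ A` has `e_K v ∉ B` (i.e. every non-zero subquotient `A / B` has a non-zero `K`-fixed
vector, `e_K` being the projector onto `K`-fixed vectors). Then `ρ.asModule` has finite length
over `k[G]`, every chain of subrepresentations having at most `dim V^K` strict steps since
`A ↦ A ∩ V^K` is strictly monotone into the subspaces of the finite-dimensional `V^K`.
(Bernstein–Zelevinsky 1976, §2.3 and proof of Thm. 4.1; Casselman 1995, §2.1.) [folklore] -/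
theorem isFiniteLength_of_forall_lt_exists_avg_not_mem (hρ : ρ.IsAdmissible) (K : OpenSubgroup G)
    (hK : IsCompact (K : Set G))
    (h : ∀ A B : Subrepresentation ρ, B < A → ∃ v ∈ A, avg ρ (K : Subgroup G) v ∉ B) :
    IsFiniteLength k[G] ρ.asModule := by
  haveI : Module.Finite k (ρ.fixedPoints (K : Subgroup G)) := hρ.2 K hK
  have hsm : StrictMono (levelSubmodule (ρ := ρ) (K : Subgroup G)) :=
    levelSubmodule_strictMono hρ.isSmooth hK h
  have hsm' : StrictMono (levelSubmodule (ρ := ρ) (K : Subgroup G) ∘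
      (Subrepresentation.subrepresentationSubmoduleOrderIso (ρ := ρ)).symm) :=
    hsm.comp (OrderIso.strictMono _)
  haveI : WellFoundedGT (Submodule k (ρ.fixedPoints (K : Subgroup G))) :=
    isNoetherian_iff'.1 inferInstance
  rw [isFiniteLength_iff_isNoetherian_isArtinian, isNoetherian_iff']
  exact ⟨hsm'.wellFoundedGT, hsm'.wellFoundedLT⟩

end Level

end Representation
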